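import Summits.QuantumFields.BalabanUV.Beta.GAN24.StepCovarianceSandwichApply
import Summits.QuantumFields.BalabanUV.Beta.GAN24.ExitFaceHalfVertexSplit
import Summits.QuantumFields.BalabanUV.Beta.GAN24.EEWordReduced

/-!
# `BalabanUV.Beta.GAN24.ExchangeE2E2ChannelTools` — binder row G-an2-4 ∕ (CONV-C), W-slot (α-0), ROW (C) AT LEVELS `j ≥ 1`, tools for (W6) of the (γ) hand's memo
# `HOME/b2b-balaban-gan24-formalise-leaf-06/g52/C-LEVELS-GE1.md` §19 (`ExchangeE2E2Channel`, next file): **(a) the unit-dressed table's face–face sums are the raw table's times the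
# field-leg unit `(sf·sm)⁻¹·sf²`-factor; (b) the unit-dressed step kernel applied to `Lc`-periodic bounded field-leg data is `Lc`-periodic; (c) its sandwich between two value Hessians on
# zero-contour-sum data is `sf²·wVH⁻¹·E2` (L4′ through the field-leg units)** — every `j`, in-block root, every `d`, `Lc ≥ 1`
# (G-an2-4 CRUX TEAM (2), seat `b2b-balaban-gan24-formalise-leaf-06` = the (γ) hand, gen 52; journal INTENT I-leaf06-g52-8)

NOT IN PRINT; OUR BOOKKEEPING ([folklore] BY NAME: `HessKerDressedUnits.unitS_apply` ∕ `unitK_apply` ∕ `legScale_inl`, leaf-04's `EEWordReduced.shiftK_dressedStep`, this lineage's L4′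
`StepCovarianceSandwichApply.tsum_E2_G_E2_apply_of_contourSum_eq_zero`; 0 `def`, 0 cited fact, 0 `def … : Prop`, 0 sorry).
HONEST FRAMING (cell contract, verbatim): «discharging `BetaPertH` makes Bałaban's UV stability UNCONDITIONAL — a real constructive-QFT result; it is NOT the continuum
limit and NOT the Clay problem.»  HONEST DEPENDENCY (verbatim): «continuum YM on T⁴ ⇐ BetaPertH ∧ nine spine estimates (0/9 proved); BetaPertH ⇐ (D1) ∧ (D4) ∧ CAP+tail;
G-an2-4 gates asym, D1 and NE2/3/4.»
* §1 `unitS_smul_inl_inl`, **`faceface_unitS_smul`** — units and the sector weight pass through the two-face sums on field legs.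
* §2 `tsum_unitK_inl_inl_mul`, **`dressedStep_apply_periodic`** — `X̃_j` on `Lc`-periodic bounded field-leg data is `Lc`-periodic (block covariance `shiftK_dressedStep`).
* §3 **`tsum_E2_unitK_E2_apply_of_contourSum_eq_zero`** — `E2 (X̃_{ff} (E2 h)) = sf²·wVH⁻¹·E2 h` for bounded `h` with `contourSum Lc h = 0`.
Asserts NO value of Bałaban's tables; discharges NOTHING of (C) ∕ (C)sym ∕ (Q-L) ∕ «T2Shape» ∕ «T2Drift» ∕ (hW, hWall); NEVER «G-an2-4 closed» as (CONV-C); NOT D1, NOT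
`BetaPertH`, NOT continuum, NOT Clay.  2026-08-23; no existing file touched.
-/

noncomputable section

open Finset
open scoped BigOperators
open Literature.MathematicalPhysics.QuantumFieldTheory
open Literature.MathematicalPhysics.QuantumFieldTheory.Balaban1983to89
open Literature.MathematicalPhysics.QuantumFieldTheory.Balaban1983to89.Beta
open ExpKernelCalculus (Site MKer shiftK Decays)
open AffineAveraging (Form1 box toSite contourSum)
open OneStepResolventKernel (Fib)
open OneStepKernelFamily (KInvStep)
open BalabanStepJetsSucc (E2 wVH)
open Summit.QuantumFields.BalabanUV.Beta.AxialDressingRooted (coDressKBmAt one_le_of_neZero)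
open Summit.QuantumFields.BalabanUV.Beta.HessKerDressedUnits (unitK unitS legScale unitK_apply unitS_apply legScale_inl)
open Summit.QuantumFields.BalabanUV.Beta.GAN24.EEWordReduced (shiftK_dressedStep)
open Summit.QuantumFields.BalabanUV.Beta.GAN24.StepCovarianceSandwichApply (tsum_E2_G_E2_apply_of_contourSum_eq_zero)

namespace Summit.QuantumFields.BalabanUV.Beta.GAN24.ExchangeE2E2ChannelTools

variable {d : ℕ} {Lc : ℕ} [NeZero Lc]

/-! ## §1 Units and sector weight pass through the two-face sums on field legs -/

omit [NeZero Lc] in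
/-- [folklore] On field legs the unit-dressed, weighted table is `((sf·sm)⁻¹·sf⁻¹·sf⁻¹·c)` times the raw table. -/
theorem unitS_smul_inl_inl (sf sm c : ℝ) (V : Fin (d + 1) → (Fin (d + 1) → ℤ) → MKer (d + 1) (Fib d)) (κ : Fin (d + 1)) (t x z : Fin (d + 1) → ℤ)
    (a b : Fin (d + 1)) :
    unitS sf sm (fun κ u => c • V κ u) κ t x z (Sum.inl a) (Sum.inl b) = ((sf * sm)⁻¹ * (sf⁻¹ * sf⁻¹) * c) * V κ t x z (Sum.inl a) (Sum.inl b) := by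
  rw [unitS_apply]
  simp only [Pi.smul_apply, smul_eq_mul, legScale_inl]
  ring

omit [NeZero Lc] in
/-- [folklore] **UNITS AND THE SECTOR WEIGHT PASS THROUGH THE TWO-FACE SUMS** (any weights `wL wR`, any table, field legs):
`Σ'_{s′} wR s′·Σ'_t (if P t then unitS sf sm (c • V) μ t z s′ (inl b)(inl β) else 0) = ((sf·sm)⁻¹ sf⁻² c)·Σ'_{s′} wR s′·Σ'_t (if P t then V μ t z s′ (inl b)(inl β) else 0)`. -/
theorem faceface_unitS_smul (sf sm c : ℝ) (V : Fin (d + 1) → (Fin (d + 1) → ℤ) → MKer (d + 1) (Fib d)) (μ : Fin (d + 1)) (P : (Fin (d + 1) → ℤ) → Prop)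
    [DecidablePred P] (wR : (Fin (d + 1) → ℤ) → ℝ) (z : Fin (d + 1) → ℤ) (b β : Fin (d + 1)) :
    (∑' s' : Fin (d + 1) → ℤ, wR s' * ∑' t : Fin (d + 1) → ℤ, (if P t then unitS sf sm (fun κ u => c • V κ u) μ t z s' (Sum.inl b) (Sum.inl β) else 0)) =
      ((sf * sm)⁻¹ * (sf⁻¹ * sf⁻¹) * c) *
        ∑' s' : Fin (d + 1) → ℤ, wR s' * ∑' t : Fin (d + 1) → ℤ, (if P t then V μ t z s' (Sum.inl b) (Sum.inl β) else 0) := by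
  have hin : ∀ s' : Fin (d + 1) → ℤ, (∑' t : Fin (d + 1) → ℤ, (if P t then unitS sf sm (fun κ u => c • V κ u) μ t z s' (Sum.inl b) (Sum.inl β) else 0)) =
      ((sf * sm)⁻¹ * (sf⁻¹ * sf⁻¹) * c) * ∑' t : Fin (d + 1) → ℤ, (if P t then V μ t z s' (Sum.inl b) (Sum.inl β) else 0) := by
    intro s'
    rw [← tsum_mul_left]
    refine tsum_congr fun t => ?_
    split_ifs
    · exact unitS_smul_inl_inl sf sm c V μ t z s' b β
    · exact (mul_zero _).symm
  simp_rw [hin]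
  rw [← tsum_mul_left]
  exact tsum_congr fun s' => by ring

/-! ## §2 The unit-dressed step kernel on periodic bounded field-leg data -/

omit [NeZero Lc] in
/-- [folklore] On field legs the unit-dressed kernel is `sf²` times the kernel. -/
theorem unitK_inl_inl (sf sm : ℝ) (K : MKer (d + 1) (Fib d)) (x z : Fin (d + 1) → ℤ) (a b : Fin (d + 1)) :
    unitK sf sm K x z (Sum.inl a) (Sum.inl b) = (sf * sf) * K x z (Sum.inl a) (Sum.inl b) := by
  rw [unitK_apply, legScale_inl, legScale_inl]
  ring

/-- [folklore] **THE DRESSED STEP KERNEL ON `Lc`-PERIODIC FIELD-LEG DATA IS `Lc`-PERIODIC** (block covariance `shiftK_dressedStep`; no summability needed — a re-indexing):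
`(X̃_j h)(a, x + Lc•t) = (X̃_j h)(a, x)` for `h b (z + Lc•t) = h b z`. -/
theorem dressedStep_apply_periodic {r : Fin (d + 1) → ℕ} (sf sm : ℝ) (j : ℕ) {h : Fin (d + 1) → (Fin (d + 1) → ℤ) → ℝ}
    (hh : ∀ b z t, h b (z + (Lc : ℤ) • t) = h b z) (a : Fib d) (x t : Fin (d + 1) → ℤ) :
    (∑' z, ∑ b : Fin (d + 1), unitK sf sm (coDressKBmAt (toSite r) Lc (KInvStep (d := d) Lc j)) (x + (Lc : ℤ) • t) z a (Sum.inl b) * h b z) =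
      ∑' z, ∑ b : Fin (d + 1), unitK sf sm (coDressKBmAt (toSite r) Lc (KInvStep (d := d) Lc j)) x z a (Sum.inl b) * h b z := by
  have hLc : 1 ≤ Lc := one_le_of_neZero Lc
  set X := unitK sf sm (coDressKBmAt (toSite r) Lc (KInvStep (d := d) Lc j)) with hXdef
  have hX : ∀ (z : Fin (d + 1) → ℤ) (b : Fib d), X (x + (Lc : ℤ) • t) z a b = X x (z - (Lc : ℤ) • t) a b := by
    intro z b
    have h := congrFun (congrFun (congrFun (congrFun (shiftK_dressedStep (r := r) hLc sf sm j t) (x + (Lc : ℤ) • t)) z) a) b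
    rw [← hXdef] at h
    -- `shiftK (−Lc•t) X (x + Lc•t) z = X (x + Lc•t) z`, i.e. `X x (z − Lc•t) = X (x + Lc•t) z`
    simp only [shiftK, add_neg_cancel_right] at h
    rw [← h, sub_eq_add_neg]
  simp_rw [hX]
  rw [← (Equiv.addRight ((Lc : ℤ) • t)).tsum_eq (fun z => ∑ b : Fin (d + 1), X x (z - (Lc : ℤ) • t) a (Sum.inl b) * h b z)]
  refine tsum_congr fun z => Finset.sum_congr rfl fun b _ => ?_
  simp only [Equiv.coe_addRight, add_sub_cancel_right, hh]

/-! ## §3 The sandwich through the field-leg units -/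

/-- [folklore] **`E2 (X̃_{ff} (E2 h)) = sf²·wVH⁻¹·E2 h`** for bounded field-leg data `h` with zero `Lc`-block contour sums (L4′ `tsum_E2_G_E2_apply_of_contourSum_eq_zero` through
`unitK_inl_inl`; every `j`, in-block root `toSite r`). -/
theorem tsum_E2_unitK_E2_apply_of_contourSum_eq_zero {r : Fin (d + 1) → ℕ} (hr : r ∈ box (d + 1) Lc) (sf sm : ℝ) (j : ℕ)
    {h : Fin (d + 1) → (Fin (d + 1) → ℤ) → ℝ} {B : ℝ} (hhB : ∀ b z, |h b z| ≤ B) (h0 : ∀ κ y, contourSum Lc h κ y = 0) (x : Fin (d + 1) → ℤ)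
    (a : Fin (d + 1)) :
    (∑' y, ∑ l : Fin (d + 1), E2 d Lc (j + 1) x y (Sum.inl a) (Sum.inl l) *
        ∑' w, ∑ l' : Fin (d + 1), unitK sf sm (coDressKBmAt (toSite r) Lc (KInvStep (d := d) Lc (j + 1))) y w (Sum.inl l) (Sum.inl l') *
          ∑' z, ∑ b : Fin (d + 1), E2 d Lc (j + 1) w z (Sum.inl l') (Sum.inl b) * h b z) =
      (sf * sf) * ((wVH d Lc (j + 1))⁻¹ * ∑' z, ∑ b : Fin (d + 1), E2 d Lc (j + 1) x z (Sum.inl a) (Sum.inl b) * h b z) := by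
  rw [← tsum_E2_G_E2_apply_of_contourSum_eq_zero hr j hhB h0 x a, ← tsum_mul_left]
  refine tsum_congr fun y => ?_
  rw [Finset.mul_sum]
  refine Finset.sum_congr rfl fun l _ => ?_
  have hin : (∑' w, ∑ l' : Fin (d + 1), unitK sf sm (coDressKBmAt (toSite r) Lc (KInvStep (d := d) Lc (j + 1))) y w (Sum.inl l) (Sum.inl l') *
        ∑' z, ∑ b : Fin (d + 1), E2 d Lc (j + 1) w z (Sum.inl l') (Sum.inl b) * h b z) =
      (sf * sf) * ∑' w, ∑ l' : Fin (d + 1), coDressKBmAt (toSite r) Lc (KInvStep (d := d) Lc (j + 1)) y w (Sum.inl l) (Sum.inl l') *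
        ∑' z, ∑ b : Fin (d + 1), E2 d Lc (j + 1) w z (Sum.inl l') (Sum.inl b) * h b z := by
    rw [← tsum_mul_left]
    refine tsum_congr fun w => ?_
    rw [Finset.mul_sum]
    refine Finset.sum_congr rfl fun l' _ => ?_
    rw [unitK_inl_inl]
    ring
  rw [hin]
  ring

end Summit.QuantumFields.BalabanUV.Beta.GAN24.ExchangeE2E2ChannelTools

end
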